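import Summits.ResolutionOfSingularities.ResolutionOfSingularities.Theorems.PurelyInseparableDim4ResConeVertexTop
import HarnessLib
import HarnessLib.Audit.Tags

/-!
# Purely inseparable four-folds — THE POLAR KERNEL IN COORDINATES: `e_i ∈ resVertex s ⟺ ∂_i g = 0`, and for
# residual degree `d < p` this means `g` is `x_i`-free

[OURS · counted 0 · cell `res-dim4-pi` · seat res-dim4-p-12 g2 · K2(p) lane (desk WORD #66 (2)).]  Nothing
here proves K2(p), `NoIsolatedTrap p p` or resolution of singularities in dimension ≥ 4 / characteristic `p`.

The coordinate reading of the polar kernel used by the idea cards (I-4-7 / I-4-8 / I-1-5: «the vertex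
contains the `x_i`-axis iff the cone does not involve `x_i`»): `single_mem_additiveSubspace_iff_pderiv_eq_zero`
(any form), and — honest ONLY for degree `< p` — `free_of_pderiv_eq_zero` /
`single_mem_additiveSubspace_iff_free` (`∂_i g = 0` with `deg g < p` forces every `x_i`-exponent to vanish,
by `…VertexTop.natCast_apply_eq_zero_of_pderiv_eq_zero` and `CharP`).  For `d ≥ p` the equivalence fails
(`g = x_i^p`), which is exactly the blindness recorded in `…VertexTop`.
bears_on: LADDER-RESOLUTION:D157-DOOR2 (res-dim4-pi · K2(p)).  Supports stmt-ResolutionOfSingularities-16155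
(helper).
-/

set_option linter.dupNamespace false -- mandated namespace of this single-conjunct summit

noncomputable section

namespace Summit.ResolutionOfSingularities.ResolutionOfSingularities.Theorems.PIDim4

namespace ResCone

open MvPolynomial Finset
open Literature.AlgebraicGeometry.Resolution
open Literature.AlgebraicGeometry.Resolution.CentreBlowup
open Literature.AlgebraicGeometry.Resolution.Hauser2010
open Literature.AlgebraicGeometry.Resolution.HauserPerlega2019
open PointBlowup (polarMap additiveSubspace direction)

variable {K : Type} [Field K]

/-- **`e_i` lies in the polar kernel iff `∂_i Φ = 0`.** [folklore] -/
theorem single_mem_additiveSubspace_iff_pderiv_eq_zero (Φ : MvPolynomial (Fin 4) K) (i : Fin 4) :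
    (Pi.single i 1 : Fin 4 → K) ∈ additiveSubspace Φ ↔ pderiv i Φ = 0 := by
  unfold additiveSubspace
  rw [LinearMap.mem_ker, polarMap_single]

/-- The same for the residual cone: `e_i ∈ resVertex s ↔ ∂_i (resForm s) = 0`. [folklore] -/
theorem single_mem_resVertex_iff_pderiv_eq_zero (s : State K) (i : Fin 4) :
    (Pi.single i 1 : Fin 4 → K) ∈ resVertex s ↔ pderiv i (resForm s) = 0 :=
  single_mem_additiveSubspace_iff_pderiv_eq_zero (resForm s) i

/-- **Below the characteristic, `∂_i g = 0` means `g` is `x_i`-free**: for a homogeneous `g` of degree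
`d < p` over a field of characteristic `p`. [folklore] -/
theorem free_of_pderiv_eq_zero (p : ℕ) [Fact p.Prime] [CharP K p] {g : MvPolynomial (Fin 4) K} {d : ℕ}
    (hg : g.IsHomogeneous d) (hd : d < p) {i : Fin 4} (h : pderiv i g = 0) :
    ∀ e ∈ g.support, e i = 0 := by
  intro e he
  have hdvd : p ∣ e i := (CharP.cast_eq_zero_iff K p (e i)).mp (natCast_apply_eq_zero_of_pderiv_eq_zero h he)
  have hdeg : e.degree = d := by
    have := hg (MvPolynomial.mem_support_iff.mp he)
    rwa [weight_one_eq_degree] at this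
  have hle : e i ≤ e.degree := by
    rw [Finsupp.degree_eq_sum]
    exact Finset.single_le_sum (fun k _ => Nat.zero_le (e k)) (Finset.mem_univ i)
  exact Nat.eq_zero_of_dvd_of_lt hdvd (by omega)

/-- **The polar kernel in coordinates, degree `< p`**: `e_i ∈ additiveSubspace g ⟺ g is x_i-free`.
[folklore] -/
theorem single_mem_additiveSubspace_iff_free (p : ℕ) [Fact p.Prime] [CharP K p]
    {g : MvPolynomial (Fin 4) K} {d : ℕ} (hg : g.IsHomogeneous d) (hd : d < p) (i : Fin 4) :
    (Pi.single i 1 : Fin 4 → K) ∈ additiveSubspace g ↔ ∀ e ∈ g.support, e i = 0 := by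
  refine ⟨fun h => free_of_pderiv_eq_zero p hg hd
    ((single_mem_additiveSubspace_iff_pderiv_eq_zero g i).mp h), single_mem_additiveSubspace_of_free⟩

/-- The residual-cone version in the band: for `x^r ∣ F`, `ord₀ F = o`, shade `o − |r| < p`:
`e_i ∈ resVertex s ⟺ resForm s is x_i-free`. [folklore] -/
theorem single_mem_resVertex_iff_free (p : ℕ) [Fact p.Prime] [CharP K p] {s : State K} {o : ℕ}
    (ho : ordZero s.F = o) (hd : o - s.r.degree < p) (i : Fin 4) :
    (Pi.single i 1 : Fin 4 → K) ∈ resVertex s ↔ ∀ e ∈ (resForm s).support, e i = 0 :=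
  single_mem_additiveSubspace_iff_free p (resForm_isHomogeneous ho) hd i

/-- Consequently, below the characteristic a FULL polar kernel is impossible for a non-constant cone:
`d = o − |r|` with `0 < d < p` ⇒ `resVertex s ≠ ⊤` (all four letters would be absent from a non-zero form of
positive degree). [folklore] -/
theorem resVertex_ne_top_of_shade_lt (p : ℕ) [Fact p.Prime] [CharP K p] {s : State K} {o : ℕ}
    (ho : ordZero s.F = o) (hr : ∀ d ∈ s.F.support, s.r ≤ d) (hd0 : 0 < o - s.r.degree)
    (hd : o - s.r.degree < p) : resVertex s ≠ ⊤ := by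
  intro htop
  have hdvd := dvd_shade_of_resVertex_eq_top p ho hr htop
  exact absurd (Nat.le_of_dvd hd0 hdvd) (by omega)

end ResCone

end Summit.ResolutionOfSingularities.ResolutionOfSingularities.Theorems.PIDim4

end
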